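import Literature.Geometry.Lorentzian.CurvatureNaturality
import HarnessLib

/-!
# Naturality of the Hessian and of the wave operator under local diffeomorphisms

Companion of `ConnectionNaturality.lean` / `CurvatureNaturality.lean` (same setting: a smooth
equidimensional immersion `Φ : N → M`, a smooth metric `g` on `M`, its pullback `Φ^* g`), used to
read the Laplace–Beltrami operator of a Riemannian `3`-manifold in a chart (the conformal
transformation law of scalar curvature, `ConformalChange.lean`). We prove

* `hessianAux_comap_mpullback` — the bare Hessian operation is natural on pulled-back fields:
  `(X(Y(f∘Φ)) − (∇^{Φ^*g}_X Y)(f∘Φ))(u) = (X̃(Ỹ f) − (∇^g_{X̃} Ỹ) f)(Φ u)` for `X = Φ^*X̃`,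
  `Y = Φ^*Ỹ` (chain rule, and naturality of the Levi-Civita connection,
  `leviCivita_comap_mpullback_mpullback`);
* `hessian_comap_apply` — **naturality of the Hessian**:
  `Hess^{Φ^*g}(f ∘ Φ)_u (X₀, Y₀) = Hess^g f_{Φ u} (dΦ X₀, dΦ Y₀)` for `f` of class `C²` at `Φ u`
  (O'Neill 1983, Ch. 3, Def. 3.48–Lemma 3.49 with Prop. 3.59: isometries preserve `∇`, hence
  `∇df`);
* `dalembertian_comap` — **naturality of the wave / Laplace–Beltrami operator**:
  `□_{Φ^*g}(f ∘ Φ)(u) = □_g f (Φ u)` (metric traces in the bases `β` and `dΦ β`, as in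
  `scalarCurvature_comap`).

Everything is proved; no named facts are introduced.

## References

* B. O'Neill, *Semi-Riemannian geometry* (1983), Ch. 3, Def. 3.48, Lemma 3.49, Prop. 3.59,
  pp. 90–91 (local isometries).
-/

noncomputable section

open Bundle Set Function Filter FiberBundle VectorField ContinuousLinearMap
open scoped Manifold ContDiff Topology

namespace Literature.Geometry.Lorentzian

namespace PseudoRiemannianMetric

variable {E : Type*} [NormedAddCommGroup E] [NormedSpace ℝ E] {H : Type*} [TopologicalSpace H]
  {I : ModelWithCorners ℝ E H} {M : Type*} [TopologicalSpace M] [ChartedSpace H M]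
  [IsManifold I ∞ M]
  {E' : Type*} [NormedAddCommGroup E'] [NormedSpace ℝ E'] {H' : Type*} [TopologicalSpace H']
  {I' : ModelWithCorners ℝ E' H'} {N : Type*} [TopologicalSpace N] [ChartedSpace H' N]
  [IsManifold I' ∞ N]
  [FiniteDimensional ℝ E] [FiniteDimensional ℝ E'] [CompleteSpace E] [CompleteSpace E']
  (g : PseudoRiemannianMetric I ∞ E (TangentSpace I : M → Type _))
  {Φ : N → M} (hpb : contMDiff_pullbackBilin I M I' N ∞) (hΦ : ContMDiff I' I (∞ + 1) Φ)
  (hΦ' : ∀ u, Function.Injective (mfderiv I' I Φ u))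
  (hdim : Module.finrank ℝ E' = Module.finrank ℝ E)

/-! ### The Hessian operation on pulled-back fields -/

omit [CompleteSpace E] [CompleteSpace E'] in
include hΦ' in
/-- **Naturality of the bare Hessian operation.** For `f : M → ℝ` of class `C²` at `Φ u` and
vector fields `X, Y` on `M` differentiable at `Φ u`,
`(Φ^*X)((Φ^*Y)(f ∘ Φ))(u) − (∇^{Φ^*g}_{Φ^*X} (Φ^*Y))(f ∘ Φ)(u) = X(Yf)(Φ u) − (∇^g_X Y) f (Φ u)`:
the inner derivative is `(Yf) ∘ Φ` near `u` and the outer one is `X(Yf)(Φ u)` (chain rule,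
`dΦ (Φ^*Y) = Y ∘ Φ`); the connection term is the pullback of `∇^g_X Y`
(`leviCivita_comap_mpullback_mpullback`). O'Neill 1983, Ch. 3, Lemma 3.49 with Prop. 3.59.
[cite: ONeill1983, Ch. 3, Prop. 3.59] -/
theorem hessianAux_comap_mpullback [g.HasLeviCivita] [(g.comap hpb Φ hΦ hΦ' hdim).HasLeviCivita]
    {u : N} {f : M → ℝ} (hf : CMDiffAt 2 f (Φ u)) {X Y : Π x : M, TangentSpace I x}
    (hY : MDiffAt (T% Y) (Φ u)) :
    (g.comap hpb Φ hΦ hΦ' hdim).hessianAux (f ∘ Φ) (mpullback I' I Φ X) (mpullback I' I Φ Y) u =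
      g.hessianAux f X Y (Φ u) := by
  have hΦs : ContMDiff I' I ∞ Φ := hΦ.of_le le_self_add
  have hΦu : MDifferentiableAt I' I Φ u := (hΦs u).mdifferentiableAt (by simp)
  have hf1 : MDifferentiableAt I 𝓘(ℝ, ℝ) f (Φ u) := hf.mdifferentiableAt (by norm_num)
  simp only [hessianAux]
  congr 1
  · -- the iterated derivative: the inner function is `(Yf) ∘ Φ` near `u`
    have hev : ∀ᶠ y in 𝓝 u, MDifferentiableAt I 𝓘(ℝ, ℝ) f (Φ y) := by
      have h1 : ∀ᶠ x in 𝓝 (Φ u), CMDiffAt 2 f x :=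
        (contMDiffAt_iff_contMDiffAt_nhds (by simp)).1 hf
      have h2 := (hΦs u).continuousAt.eventually h1
      exact h2.mono fun y hy ↦ hy.mdifferentiableAt (by norm_num)
    have heq : (fun y ↦ mvfderiv I' (f ∘ Φ) y (mpullback I' I Φ Y y)) =ᶠ[𝓝 u]
        (fun x ↦ mvfderiv I f x (Y x)) ∘ Φ := by
      filter_upwards [hev] with y hy
      have hΦy : MDifferentiableAt I' I Φ y := (hΦs y).mdifferentiableAt (by simp)
      change mvfderiv I' (f ∘ Φ) y (mpullback I' I Φ Y y) = mvfderiv I f (Φ y) (Y (Φ y))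
      rw [mvfderiv_comp_apply hy hΦy, mfderiv_mpullback_apply hΦ' hdim]
    have key := heq.mfderiv_eq (I := I') (I' := 𝓘(ℝ, ℝ))
    have h1 : mvfderiv I' (fun y ↦ mvfderiv I' (f ∘ Φ) y (mpullback I' I Φ Y y)) u
        (mpullback I' I Φ X u) =
        mvfderiv I' ((fun x ↦ mvfderiv I f x (Y x)) ∘ Φ) u (mpullback I' I Φ X u) := by
      change mfderiv I' 𝓘(ℝ, ℝ) (fun y ↦ mvfderiv I' (f ∘ Φ) y (mpullback I' I Φ Y y)) u
          (mpullback I' I Φ X u) =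
        mfderiv I' 𝓘(ℝ, ℝ) ((fun x ↦ mvfderiv I f x (Y x)) ∘ Φ) u (mpullback I' I Φ X u)
      rw [key]
      rfl
    rw [h1, mvfderiv_comp_apply (mdifferentiableAt_mvfderiv_apply hf hY) hΦu,
      mfderiv_mpullback_apply hΦ' hdim]
  · -- the connection term is the pullback of `∇_X Y`
    rw [g.leviCivita_comap_mpullback_mpullback hpb hΦ hΦ' hdim hY, mvfderiv_comp_apply hf1 hΦu,
      mfderiv_mpullback_apply hΦ' hdim]

/-! ### Naturality of the Hessian and of the wave operator -/

include hΦ' in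
/-- **Naturality of the Hessian under local diffeomorphisms**: for `f : M → ℝ` of class `C²` at
`Φ u` and `X₀, Y₀ ∈ T_u N`,
`Hess^{Φ^*g}(f ∘ Φ)_u (X₀, Y₀) = Hess^g f_{Φ u} (dΦ_u X₀, dΦ_u Y₀)`. Both Hessians evaluate by the
classical formula (`hessian_apply_holds`) on the extensions `X̃, Ỹ` of `dΦ X₀, dΦ Y₀` and their
pullbacks `Φ^*X̃, Φ^*Ỹ` (whose values at `u` are `X₀, Y₀`), and the formula is natural
(`hessianAux_comap_mpullback`). O'Neill 1983, Ch. 3, Def. 3.48–Lemma 3.49 with Prop. 3.59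
(isometries preserve the Levi-Civita connection, hence `Hess f = ∇(df)`).
[cite: ONeill1983, Ch. 3, Prop. 3.59] -/
theorem hessian_comap_apply [g.HasLeviCivita] [(g.comap hpb Φ hΦ hΦ' hdim).HasLeviCivita]
    {u : N} {f : M → ℝ} (hf : CMDiffAt 2 f (Φ u)) (X₀ Y₀ : TangentSpace I' u) :
    (g.comap hpb Φ hΦ hΦ' hdim).hessian (f ∘ Φ) u X₀ Y₀ =
      g.hessian f (Φ u) (mfderiv I' I Φ u X₀) (mfderiv I' I Φ u Y₀) := by
  have hΦs : ContMDiff I' I ∞ Φ := hΦ.of_le le_self_add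
  have hinv : ∀ u', (mfderiv I' I Φ u').IsInvertible := fun u' ↦
    isInvertible_mfderiv_of_injective hdim (hΦ' u')
  have h2 : (2 : ℕ∞ω) ≤ ∞ := WithTop.coe_le_coe.mpr le_top
  have h2' : (2 : ℕ∞ω) ≤ ∞ + 1 := h2.trans le_self_add
  have hfΦ : CMDiffAt 2 (f ∘ Φ) u := hf.comp u ((hΦ.of_le h2') u)
  -- the extensions of `dΦ X₀, dΦ Y₀` and their pullbacks
  set X' : Π x : M, TangentSpace I x := FiberBundle.extend E (mfderiv I' I Φ u X₀) with hX'
  set Y' : Π x : M, TangentSpace I x := FiberBundle.extend E (mfderiv I' I Φ u Y₀) with hY'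
  have hX'd : MDiffAt (T% X') (Φ u) := mdifferentiableAt_extend ..
  have hY'd : MDiffAt (T% Y') (Φ u) := mdifferentiableAt_extend ..
  have hXN : MDiffAt (T% (mpullback I' I Φ X')) u := hX'd.mpullback_vectorField (hΦs u) (hinv u) h2
  have hYN : MDiffAt (T% (mpullback I' I Φ Y')) u := hY'd.mpullback_vectorField (hΦs u) (hinv u) h2
  have hXu : mpullback I' I Φ X' u = X₀ := by
    rw [hX']; exact mpullback_extend_mfderiv_apply hΦ' hdim u X₀
  have hYu : mpullback I' I Φ Y' u = Y₀ := by
    rw [hY']; exact mpullback_extend_mfderiv_apply hΦ' hdim u Y₀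
  rw [← hXu, ← hYu, (g.comap hpb Φ hΦ hΦ' hdim).hessian_apply_holds hfΦ hXN hYN,
    mfderiv_mpullback_apply hΦ' hdim, mfderiv_mpullback_apply hΦ' hdim,
    g.hessian_apply_holds hf hX'd hY'd]
  exact g.hessianAux_comap_mpullback hpb hΦ hΦ' hdim hf hY'd

include hΦ' in
/-- **Naturality of the wave operator (Laplace–Beltrami operator) under local diffeomorphisms**:
`□_{Φ^*g}(f ∘ Φ)(u) = □_g f (Φ u)` for `f` of class `C²` at `Φ u` — the metric traces
`tr_{Φ^*g} Hess^{Φ^*g}(f∘Φ)_u` and `tr_g Hess^g f_{Φ u}` agree because a basis `β` of `T_u N` and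
its image `dΦ_u β` have the same Gram matrices and, by `hessian_comap_apply`, the same Hessian
components (O'Neill 1983, Ch. 3, Prop. 3.59 and pp. 90–91: local isometries preserve all metric
invariants). [cite: ONeill1983, Ch. 3, Prop. 3.59] -/
theorem dalembertian_comap [g.HasLeviCivita] [(g.comap hpb Φ hΦ hΦ' hdim).HasLeviCivita]
    {u : N} {f : M → ℝ} (hf : CMDiffAt 2 f (Φ u)) :
    (g.comap hpb Φ hΦ hΦ' hdim).dalembertian (f ∘ Φ) u = g.dalembertian f (Φ u) := by
  haveI : FiniteDimensional ℝ (TangentSpace I' u) := inferInstanceAs (FiniteDimensional ℝ E')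
  set e := mfderivEquivOfInjective (I := I) (I' := I') Φ u (hΦ' u) hdim with he
  set β := Module.finBasis ℝ (TangentSpace I' u) with hβ
  set β' : Module.Basis (Fin (Module.finrank ℝ (TangentSpace I' u))) ℝ (TangentSpace I (Φ u)) :=
    β.map e with hβ'
  rw [dalembertian, dalembertian,
    trace_eq_sum_gram_inv (g.comap hpb Φ hΦ hΦ' hdim) u β, trace_eq_sum_gram_inv g (Φ u) β']
  have hgram : (Matrix.of fun i j ↦ (g.comap hpb Φ hΦ hΦ' hdim).val u (β i) (β j)) =
      Matrix.of fun i j ↦ g.val (Φ u) (β' i) (β' j) := by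
    ext i j
    simp only [Matrix.of_apply, hβ', Module.Basis.map_apply, val_comap, pullbackBilin_apply]
    rfl
  have hhess : ∀ i j, (g.comap hpb Φ hΦ hΦ' hdim).hessian (f ∘ Φ) u (β i) (β j) =
      g.hessian f (Φ u) (β' i) (β' j) := fun i j ↦ by
    rw [g.hessian_comap_apply hpb hΦ hΦ' hdim hf (β i) (β j), hβ', Module.Basis.map_apply,
      Module.Basis.map_apply]
    rfl
  rw [hgram]
  simp only [hhess]

end PseudoRiemannianMetric

end Literature.Geometry.Lorentzian

end
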